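import Summits.CriticalPhenomena.Ising3DConformalLimit.Theses.PrimaryAtInfinity
import Summits.CriticalPhenomena.Ising3DConformalLimit.Theses.IsingEuclidUpgrade
import Summits.CriticalPhenomena.Ising3DConformalLimit.Theses.AnomalousForcesInteraction
import Summits.CriticalPhenomena.Ising3DConformalLimit.Theorems.GaussianScaleMixtureRotationUpgradeFromTwoPointEdgeGaussianity
import Summits.CriticalPhenomena.Ising3DConformalLimit.Theorems.HyperoctahedralRPTwoPointLimitIsotropicHolds
import Summits.CriticalPhenomena.Ising3DConformalLimit.Theorems.MoebiusLimitExists.Negative.ScaleRedundant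
import Summits.CriticalPhenomena.Ising3DConformalLimit.Theorems.MoebiusLimitExists.Negative.FreeTranslations
import Summits.CriticalPhenomena.Ising3DConformalLimit.Theorems.AnomalousForcesInteractionDeltaLowerBound
import Summits.CriticalPhenomena.Ising3DConformalLimit.Theorems.GaussianLimitNotScreened.Negative.Reformulation
import Summits.CriticalPhenomena.Ising3DConformalLimit.Theorems.PrimaryAtInfinityAssembly
import Literature.Barriers.CriticalPhenomena.TwoPointLawNotMoebius
import HarnessLib

/-!
# Crux `PrimaryAtInfinity.TwoPointPowerLawEta` (stmt-CriticalPhenomena-5354) reduced to `Δ > 1/2`,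
# hence to the route's own non-Gaussianity item 0636

THEOREM-ONLY file (no definitions; `--supports stmt-CriticalPhenomena-5354`, lead prover of line
`line-multipole-ward-nonsat-endpoint`, 2026-08-17).

The crux (2PT) of route `PrimaryAtInfinity` asks, for EVERY pointwise scaling limit `(ρ, S)` of the critical `ℤ³`
Ising correlators `criticalCorr 3` (`ρ > 0` on `(0,1]`) with non-degenerate two-point function, for `c > 0` and
`Δ > 1/2` with `S 2 ![a, b] = c‖a − b‖^(−2Δ)` (`a ≠ b`): isotropy, pure power law, `η = 2Δ − 1 > 0`.

Everything except the strict inequality `Δ > 1/2` is ALREADY A THEOREM of the tree for an arbitrary such limit,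
and this file assembles it (`twoPoint_structure_of_limit`):

* normalise `S` off `NonCoincident` (`MoebiusLimitExistsNegative.normalised_hasLimit/_nondeg`); the normalised family
  is translation invariant (`isTranslationInvariant_normalised_of_limit`: lattice translations pass to the limit)
  and scale covariant with some `Δ ∈ [1/2, 1]` (`exists_scaleCovariant_normalised`: self-similarity of full-filter
  limits + the Ising window), indeed `Δ ∈ [1/2, 3/4]` with `HasIsingExponentEta 3 (2Δ − 1)`
  (`GaussianLimitNotScreenedNegative.dimension_window_and_eta`, Duminil-Copin–Panis 2025 Thm 1.5);
* its two-point kernel `x ↦ S 2 ![0, x]` is `O(3)` invariant (`HyperoctahedralRPTwoPoint.kernel_rotation_invariant`: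
  nine-mirror reflection positivity of the limit kernel + the X-ray/Mellin rigidity theorem `HRP2Rigidity_of`,
  items 1979/1983/1984 of route HyperoctahedralRP, all landed);
* hence the two-point law `S 2 ![a, b] = S 2 ![0, e₀] · ‖a − b‖^(−2Δ)` (`RotationUpgradeFromTwoPointNegative.two_point_law`);
* and `U₄ ≢ 0 ⇒ 1/2 < Δ` (`NullLaplacianEdgeGaussianity.half_lt_delta_of_hasNontrivialU4`: at the edge `Δ = 1/2`
  the limit is Gaussian at order four — exterior harmonicity, analyticity off a finite set, Bôcher–Liouville).

Consequences landed here: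

* `stub_twoPointStructure` — the registered glue stub of the crux skeleton (rev. 4), by name: `∃ Δ` with
  `U₄ ≢ 0 ⇒ 1/2 < Δ` and the isotropic law (corollary of `twoPoint_structure_of_limit`);
* `twoPointPowerLawEta_iff_half_lt_delta` — **the exact residual content of the crux**: (2PT) holds iff every
  non-degenerate pointwise limit of `criticalCorr 3` has scaling dimension `> 1/2` (equivalently `η > 0`);
* `twoPointPowerLawEta_of_nonGaussian` (and primed spelling) — **5354 ⇐ 0636**: the route's own rank-6 crux
  `IsingEuclidUpgradeR4NonGaussian` (every non-degenerate limit has `U₄ ≢ 0`) implies the rank-4 crux, so in the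
  assembly of route `PrimaryAtInfinity` item 5354 is REDUNDANT given item 0636;
* `twoPointPowerLawEta_of_etaPosOfExists` — 5354 ⇐ "`η > 0` whenever `η` exists"
  (`∀ η, HasIsingExponentEta 3 η → 0 < η`), and `twoPointPowerLawEta_of_etaPositive` — 5354 ⇐ item 2600
  `AnomalousForcesInteraction.EtaPositive` (via the landed `DeltaLowerBound_proof`);
* `twoPointPowerLawEta_of_not_etaZero` — the WEAKEST lattice sufficient condition: if the critical two-point function
  does NOT have logarithmic exponent exactly `1` (`¬ HasIsingExponentEta 3 0`, the negation of the branch hypothesis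
  `CanonicalBranchRefutation.InfraredExponentZero`, item 15521), then (2PT) holds (a limit with `Δ = 1/2` would
  produce that exponent);
* `etaPos_of_twoPointPowerLawEta` — conversely, given ONE non-degenerate limit, (2PT) forces `η > 0` for every
  logarithmic exponent `η` of the critical two-point function (so, given a limit, (2PT) ⇔ `¬ HasIsingExponentEta 3 0`);
* `assembly_without_twoPointPowerLawEta` — the route's deciding chain with item 5354 REMOVED:
  `FirstMultipoleIdentity → FarFieldClustering → ExistsRegularLimit → MultipoleToWard → WardToMoebius →
  IsingEuclidUpgradeR4NonGaussian → Ising3DConformalLimit` (landed `primaryAtInfinity_assembly_proof` fed by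
  `twoPointPowerLawEta_of_nonGaussian`).

* Appendix: `nonGaussian_of_conjunct`, `twoPointPowerLawEta_of_conjunct` — items 0636 and 5354 follow from the
  sub-problem statement `Ising3DConformalLimit` itself (all non-degenerate limits are proportional), so neither is
  stronger than the route's goal.

Not here: `Δ > 1/2` itself (open: equivalent, by the above, to excluding the Gaussian/`η = 0` alternative for
Ising₃ limits — items 0636, 2600, 1342 ∧ 0634 each suffice; none is proved).
-/

noncomputable section

namespace Summit.CriticalPhenomena.Ising3DConformalLimit.Theorems.PrimaryAtInfinityTwoPointPowerLawEta

open Filter Topology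
open Literature.Probability.LatticeModels
open Literature.Barriers.CriticalPhenomena.ScaleNotMoebius
  (axisUnit norm_axisUnit zero_axisUnit_mem_nonCoincident zero_two_smul_axisUnit_mem_nonCoincident)
open Summit.CriticalPhenomena.Ising3DConformalLimit.MoebiusLimitExistsNegative
  (normalised_hasLimit normalised_nondeg hasNontrivialU4_normalised_iff exists_scaleCovariant_normalised
   isTranslationInvariant_normalised_of_limit)
open Summit.CriticalPhenomena.Ising3DConformalLimit.HyperoctahedralRPTwoPoint (kernel_rotation_invariant)
open Summit.CriticalPhenomena.Ising3DConformalLimit.RotationUpgradeFromTwoPointNegative (two_point_law)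
open Summit.CriticalPhenomena.Ising3DConformalLimit.Cruxes.RotationUpgradeFromTwoPoint.NullLaplacianEdgeGaussianity
  (half_lt_delta_of_hasNontrivialU4)
open Summit.CriticalPhenomena.Ising3DConformalLimit.GaussianLimitNotScreenedNegative (dimension_window_and_eta)
open Summit.CriticalPhenomena.Ising3DConformalLimit.Theses

variable {ρ : ℝ → ℝ} {S : CorrFamily 3}

open Classical in
/-- **Structure of the two-point function of an arbitrary non-degenerate Ising₃ pointwise limit.** For every
pointwise scaling limit `(ρ, S)` of `criticalCorr 3` with `ρ > 0` on `(0,1]` and non-degenerate two-point function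
there is `Δ ∈ [1/2, 3/4]` such that: `η = 2Δ − 1` is the logarithmic exponent of the critical two-point function
(`HasIsingExponentEta 3 (2Δ − 1)`); the normalised family is scale covariant with dimension `Δ`; `U₄ ≢ 0` forces
`1/2 < Δ`; and the two-point function is the isotropic pure power `S 2 ![a, b] = S 2 ![0, e₀] · ‖a − b‖^(−2Δ)` for
all `a ≠ b`. Assembly of landed tree theorems (see the module docstring). -/
theorem twoPoint_structure_of_limit (hρ : ∀ δ ∈ Set.Ioc (0:ℝ) 1, 0 < ρ δ)
    (hlim : HasPointwiseScalingLimit (criticalCorr 3) ρ S) (hnd : IsNondegenerateTwoPoint S) :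
    ∃ Δ : ℝ, Δ ∈ Set.Icc (1 / 2 : ℝ) (3 / 4) ∧ HasIsingExponentEta 3 (2 * Δ - 1) ∧
      IsScaleCovariant Δ (fun n x => if x ∈ NonCoincident 3 n then S n x else 0) ∧
      (HasNontrivialU4 S → 1 / 2 < Δ) ∧
      ∀ a b : EuclideanSpace ℝ (Fin 3), a ≠ b →
        S 2 ![a, b] = S 2 ![0, axisUnit] * ‖a - b‖ ^ (-(2 * Δ)) := by
  set S' : CorrFamily 3 := fun n x => if x ∈ NonCoincident 3 n then S n x else 0 with hS'
  have hlim' : HasPointwiseScalingLimit (criticalCorr 3) ρ S' := normalised_hasLimit hlim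
  have hnd' : IsNondegenerateTwoPoint S' := normalised_nondeg hnd
  have hnorm' : ∀ n z, z ∉ NonCoincident 3 n → S' n z = 0 := fun n z hz => if_neg hz
  have htr' : IsTranslationInvariant S' := isTranslationInvariant_normalised_of_limit hlim
  obtain ⟨Δ, -, hsc'⟩ := exists_scaleCovariant_normalised hρ hlim hnd
  have hiso' : ∀ (R : EuclideanSpace ℝ (Fin 3) ≃ₗᵢ[ℝ] EuclideanSpace ℝ (Fin 3)) (x : EuclideanSpace ℝ (Fin 3)),
      x ≠ 0 → S' 2 ![0, R x] = S' 2 ![0, x] :=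
    fun R x _ => kernel_rotation_invariant hρ hlim' hnd' htr' hsc' R x
  obtain ⟨hwin, hη⟩ := dimension_window_and_eta hρ hlim' hnd' hsc'
  refine ⟨Δ, hwin, hη, hsc', fun hU4 => ?_, fun a b hab => ?_⟩
  · exact half_lt_delta_of_hasNontrivialU4 hρ hlim' hnorm' hnd' htr' hsc' hiso'
      (hasNontrivialU4_normalised_iff.2 hU4)
  · have hlaw := two_point_law htr' hsc' hiso' hab
    have h1 : S' 2 ![a, b] = S 2 ![a, b] := if_pos (pair_mem_nonCoincident hab)
    have h2 : S' 2 ![0, axisUnit] = S 2 ![0, axisUnit] := if_pos zero_axisUnit_mem_nonCoincident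
    rw [h1, h2] at hlaw
    rw [hlaw, mul_comm]

/-- **The registered glue stub `stub_twoPointStructure` of the crux skeleton
`Cruxes/TwoPointPowerLawEta/Lines/birth.lean` (rev. 4), by name and signature**: for every non-degenerate pointwise
limit there is `Δ` with `U₄ ≢ 0 ⇒ 1/2 < Δ` and the isotropic pure power law with amplitude `S 2 ![0, e₀]`,
`e₀ = EuclideanSpace.single 0 1` (a corollary of `twoPoint_structure_of_limit`; `axisUnit` unfolds to `e₀`). -/
theorem stub_twoPointStructure :
    ∀ (ρ : ℝ → ℝ) (S : CorrFamily 3), (∀ δ ∈ Set.Ioc (0:ℝ) 1, 0 < ρ δ) →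
      HasPointwiseScalingLimit (criticalCorr 3) ρ S → IsNondegenerateTwoPoint S →
      ∃ Δ : ℝ, (HasNontrivialU4 S → 1 / 2 < Δ) ∧
        ∀ a b : EuclideanSpace ℝ (Fin 3), a ≠ b →
          S 2 ![a, b] = S 2 ![0, EuclideanSpace.single 0 1] * ‖a - b‖ ^ (-(2 * Δ)) := by
  intro ρ S hρ hlim hnd
  obtain ⟨Δ, -, -, -, hgt, hlaw⟩ := twoPoint_structure_of_limit hρ hlim hnd
  exact ⟨Δ, hgt, hlaw⟩

open Classical in
/-- **The exact residual content of the crux.** `TwoPointPowerLawEta` holds iff every non-degenerate pointwise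
scaling limit of `criticalCorr 3` (`ρ > 0` on `(0,1]`) has scaling dimension `Δ > 1/2` — isotropy and the pure power
law being automatic (`twoPoint_structure_of_limit`). -/
theorem twoPointPowerLawEta_iff_half_lt_delta :
    PrimaryAtInfinity.TwoPointPowerLawEta ↔
      ∀ (ρ : ℝ → ℝ) (S : CorrFamily 3) (Δ : ℝ), (∀ δ ∈ Set.Ioc (0:ℝ) 1, 0 < ρ δ) →
        HasPointwiseScalingLimit (criticalCorr 3) ρ S → IsNondegenerateTwoPoint S →
        IsScaleCovariant Δ (fun n x => if x ∈ NonCoincident 3 n then S n x else 0) → 1 / 2 < Δ := by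
  constructor
  · intro h ρ S Δ hρ hlim hnd hsc
    obtain ⟨c, Δ₁, hc, hΔ₁, hlaw⟩ := h ρ S hρ hlim hnd
    -- compare the crux's law with scale covariance at the pairs `(0, e₀)` and `(0, 2e₀)`
    have hne1 : (0 : EuclideanSpace ℝ (Fin 3)) ≠ axisUnit := fun h0 => by
      have : ‖(axisUnit : EuclideanSpace ℝ (Fin 3))‖ = 0 := by rw [← h0, norm_zero]
      rw [norm_axisUnit] at this
      exact one_ne_zero this
    have hne2 : (0 : EuclideanSpace ℝ (Fin 3)) ≠ (2:ℝ) • axisUnit := fun h0 => by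
      have : ‖((2:ℝ) • axisUnit : EuclideanSpace ℝ (Fin 3))‖ = 0 := by rw [← h0, norm_zero]
      rw [norm_smul, norm_axisUnit, mul_one, Real.norm_eq_abs] at this
      norm_num at this
    have e1 := hlaw 0 axisUnit hne1
    have e2 := hlaw 0 ((2:ℝ) • axisUnit) hne2
    rw [zero_sub, norm_neg, norm_axisUnit, Real.one_rpow, mul_one] at e1
    rw [zero_sub, norm_neg, norm_smul, norm_axisUnit, mul_one, Real.norm_eq_abs,
      abs_of_pos (by norm_num : (0:ℝ) < 2)] at e2
    -- scale covariance of the normalised family at the reference pair, scale `2`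
    have hmem1 : (![0, axisUnit] : Fin 2 → EuclideanSpace ℝ (Fin 3)) ∈ NonCoincident 3 2 :=
      pair_mem_nonCoincident hne1
    have hmem2 : (![0, (2:ℝ) • axisUnit] : Fin 2 → EuclideanSpace ℝ (Fin 3)) ∈ NonCoincident 3 2 :=
      pair_mem_nonCoincident hne2
    have hcov := hsc 2 2 two_pos ![0, axisUnit]
    have hfun : (fun i => (2:ℝ) • (![0, axisUnit] : Fin 2 → EuclideanSpace ℝ (Fin 3)) i) =
        ![0, (2:ℝ) • axisUnit] := by
      funext i
      fin_cases i <;> simp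
    rw [hfun] at hcov
    simp only [if_pos hmem1, if_pos hmem2] at hcov
    rw [e1, e2, show (-((2:ℕ):ℝ) * Δ) = -(2 * Δ) by push_cast; ring] at hcov
    -- `c · 2^{-2Δ₁} = 2^{-2Δ} · c` with `c > 0` forces `Δ = Δ₁ > 1/2`
    have hc2 : (2:ℝ) ^ (-(2 * Δ₁)) = (2:ℝ) ^ (-(2 * Δ)) := by
      have := hcov
      field_simp at this
      linarith [this]
    have hlog := congrArg Real.log hc2
    rw [Real.log_rpow two_pos, Real.log_rpow two_pos] at hlog
    have hl2 : 0 < Real.log 2 := Real.log_pos one_lt_two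
    have : Δ₁ = Δ := by nlinarith [hlog, hl2]
    linarith
  · intro h ρ S hρ hlim hnd
    obtain ⟨Δ, -, -, hsc, -, hlaw⟩ := twoPoint_structure_of_limit hρ hlim hnd
    exact ⟨S 2 ![0, axisUnit], Δ, hnd _ zero_axisUnit_mem_nonCoincident, h ρ S Δ hρ hlim hnd hsc, hlaw⟩

/-- **5354 ⇐ 0636 (route `PrimaryAtInfinity` spelling).** If every non-degenerate pointwise scaling limit of
`criticalCorr 3` has non-trivial connected four-point function (the route's rank-6 crux
`PrimaryAtInfinity.IsingEuclidUpgradeR4NonGaussian`, item stmt-CriticalPhenomena-0636), then the rank-4 crux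
`TwoPointPowerLawEta` holds: in the route's assembly, item 5354 is redundant given item 0636. -/
theorem twoPointPowerLawEta_of_nonGaussian (h0636 : PrimaryAtInfinity.IsingEuclidUpgradeR4NonGaussian) :
    PrimaryAtInfinity.TwoPointPowerLawEta := by
  intro ρ S hρ hlim hnd
  obtain ⟨Δ, -, -, -, hgt, hlaw⟩ := twoPoint_structure_of_limit hρ hlim hnd
  exact ⟨S 2 ![0, axisUnit], Δ, hnd _ zero_axisUnit_mem_nonCoincident, hgt (h0636 ρ S hρ hlim hnd), hlaw⟩

/-- **5354 ⇐ 0636 (route `IsingEuclidUpgrade` spelling of item 0636).** -/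
theorem twoPointPowerLawEta_of_nonGaussian' (h0636 : IsingEuclidUpgrade.IsingEuclidUpgradeR4NonGaussian) :
    PrimaryAtInfinity.TwoPointPowerLawEta :=
  twoPointPowerLawEta_of_nonGaussian fun ρ S hρ hlim hnd => h0636 ρ S hρ hlim hnd

/-- **5354 ⇐ "η > 0 whenever η exists".** If every logarithmic exponent `η` of the critical `ℤ³` two-point function
(`HasIsingExponentEta 3 η`) is positive, then `TwoPointPowerLawEta` holds (`η = 2Δ − 1` exists for every
non-degenerate limit). -/
theorem twoPointPowerLawEta_of_etaPosOfExists (hE : ∀ η : ℝ, HasIsingExponentEta 3 η → 0 < η) :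
    PrimaryAtInfinity.TwoPointPowerLawEta := by
  intro ρ S hρ hlim hnd
  obtain ⟨Δ, -, hη, -, -, hlaw⟩ := twoPoint_structure_of_limit hρ hlim hnd
  have hΔ : 1 / 2 < Δ := by
    have h := hE _ hη
    linarith
  exact ⟨S 2 ![0, axisUnit], Δ, hnd _ zero_axisUnit_mem_nonCoincident, hΔ, hlaw⟩

open Classical in
/-- **5354 ⇐ 2600.** A power-law upper bound `⟨σ₀σ_x⟩_{β_c} ≤ C‖x‖^{−(1+κ)}` with `κ > 0` on `ℤ³` (crux
`AnomalousForcesInteraction.EtaPositive`, item stmt-CriticalPhenomena-2600) implies `TwoPointPowerLawEta`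
(through the landed `DeltaLowerBound_proof`: `1 + κ ≤ 2Δ`). -/
theorem twoPointPowerLawEta_of_etaPositive (h2600 : AnomalousForcesInteraction.EtaPositive) :
    PrimaryAtInfinity.TwoPointPowerLawEta := by
  rw [twoPointPowerLawEta_iff_half_lt_delta]
  intro ρ S Δ hρ hlim hnd hsc
  obtain ⟨κ, C, hκ, hbd⟩ := h2600
  have h := DeltaLowerBound_proof (1 + κ) C ρ Δ _ hbd hρ (normalised_hasLimit hlim) (normalised_nondeg hnd) hsc
  linarith

/-- **Conversely: given one non-degenerate limit, (2PT) forces `η > 0`** for every logarithmic exponent `η` of the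
critical two-point function (the exponent is unique along `cofinite`, and equals `2Δ − 1` for the limit's `Δ`). -/
theorem etaPos_of_twoPointPowerLawEta (h : PrimaryAtInfinity.TwoPointPowerLawEta)
    (hρ : ∀ δ ∈ Set.Ioc (0:ℝ) 1, 0 < ρ δ)
    (hlim : HasPointwiseScalingLimit (criticalCorr 3) ρ S) (hnd : IsNondegenerateTwoPoint S)
    {η : ℝ} (hη : HasIsingExponentEta 3 η) : 0 < η := by
  classical
  obtain ⟨Δ, -, hηΔ, hsc, -, -⟩ := twoPoint_structure_of_limit hρ hlim hnd
  have hΔ : 1 / 2 < Δ := (twoPointPowerLawEta_iff_half_lt_delta.1 h) ρ S Δ hρ hlim hnd hsc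
  -- uniqueness of the logarithmic exponent along `cofinite` on the infinite lattice `ℤ³`
  have huniq : -((3:ℝ) - 2 + η) = -((3:ℝ) - 2 + (2 * Δ - 1)) := by
    unfold HasIsingExponentEta HasSpatialDecayExponent at hη hηΔ
    push_cast at hη hηΔ
    exact tendsto_nhds_unique hη hηΔ
  linarith

/-- **5354 ⇐ ¬(η = 0)** — the weakest lattice sufficient condition: if the critical `ℤ³` two-point function does NOT
have logarithmic decay exponent exactly `1` (`¬ HasIsingExponentEta 3 0`), then `TwoPointPowerLawEta` holds, since a
non-degenerate limit with `Δ = 1/2` would produce exactly that exponent (`η = 2Δ − 1 = 0`). -/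
theorem twoPointPowerLawEta_of_not_etaZero (h0 : ¬ HasIsingExponentEta 3 0) :
    PrimaryAtInfinity.TwoPointPowerLawEta := by
  intro ρ S hρ hlim hnd
  obtain ⟨Δ, hwin, hη, -, -, hlaw⟩ := twoPoint_structure_of_limit hρ hlim hnd
  have hΔ : 1 / 2 < Δ := by
    rcases eq_or_lt_of_le hwin.1 with heq | hlt
    · exfalso
      apply h0
      have e : 2 * Δ - 1 = 0 := by rw [← heq]; norm_num
      rwa [e] at hη
    · exact hlt
  exact ⟨S 2 ![0, axisUnit], Δ, hnd _ zero_axisUnit_mem_nonCoincident, hΔ, hlaw⟩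

/-- **The route's deciding chain with item 5354 removed**: `FirstMultipoleIdentity → FarFieldClustering →
ExistsRegularLimit → MultipoleToWard → WardToMoebius → IsingEuclidUpgradeR4NonGaussian → Ising3DConformalLimit`
(the landed assembly `primaryAtInfinity_assembly_proof`, its third hypothesis supplied by
`twoPointPowerLawEta_of_nonGaussian` from its last). -/
theorem assembly_without_twoPointPowerLawEta
    (h₁ : PrimaryAtInfinity.FirstMultipoleIdentity) (h₂ : PrimaryAtInfinity.FarFieldClustering)
    (h₄ : PrimaryAtInfinity.ExistsRegularLimit) (h₅ : PrimaryAtInfinity.MultipoleToWard)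
    (h₆ : PrimaryAtInfinity.WardToMoebius) (h₇ : PrimaryAtInfinity.IsingEuclidUpgradeR4NonGaussian) :
    Ising3DConformalLimit :=
  Summit.CriticalPhenomena.Ising3DConformalLimit.Theorems.primaryAtInfinity_assembly_proof h₁ h₂
    (twoPointPowerLawEta_of_nonGaussian h₇) h₄ h₅ h₆ h₇

/-! ### Appendix (2026-08-17, same lead): items 0636 and 5354 are NECESSARY — consequences of the sub-problem

All non-degenerate pointwise limits of the same lattice family are proportional on non-coincident configurations
(`HasPointwiseScalingLimit.exists_scale_of_isNondegenerateTwoPoint`), and `U₄ ≢ 0` is invariant under such a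
rescaling (`hasNontrivialU4_iff_of_scale`); so the ONE non-Gaussian limit provided by the sub-problem statement
`Ising3DConformalLimit` makes EVERY non-degenerate limit non-Gaussian (item 0636), hence (2PT) (item 5354). Neither
item is therefore stronger than the goal of the route. -/

/-- **0636 ⇐ the sub-problem.** `Ising3DConformalLimit` (one non-degenerate, Möbius-covariant, non-Gaussian limit)
implies `IsingEuclidUpgradeR4NonGaussian` (every non-degenerate limit is non-Gaussian): two non-degenerate pointwise
limits of `criticalCorr 3` differ by a positive scale `κⁿ` on non-coincident configurations, which does not affect
`U₄ ≢ 0`. -/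
theorem nonGaussian_of_conjunct (h : Ising3DConformalLimit) :
    PrimaryAtInfinity.IsingEuclidUpgradeR4NonGaussian := by
  intro ρ S hρ hlim hnd
  obtain ⟨ρ₀, Δ₀, S₀, hρ₀, -, hlim₀, hnd₀, -, hU4₀⟩ := h
  obtain ⟨κ, hκ, hscale⟩ :=
    hlim₀.exists_scale_of_isNondegenerateTwoPoint (by norm_num : 0 < 3) hρ₀ hρ hlim hnd₀ hnd
  exact (hasNontrivialU4_iff_of_scale hκ.ne' hscale).2 hU4₀

/-- **5354 ⇐ the sub-problem.** `Ising3DConformalLimit` implies `TwoPointPowerLawEta`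
(`nonGaussian_of_conjunct` + `twoPointPowerLawEta_of_nonGaussian`). -/
theorem twoPointPowerLawEta_of_conjunct :
    Ising3DConformalLimit → Summit.CriticalPhenomena.Ising3DConformalLimit.Theses.PrimaryAtInfinity.TwoPointPowerLawEta :=
  fun h => twoPointPowerLawEta_of_nonGaussian (nonGaussian_of_conjunct h)

end Summit.CriticalPhenomena.Ising3DConformalLimit.Theorems.PrimaryAtInfinityTwoPointPowerLawEta

end
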